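import Summits.CriticalPhenomena.PercolationContinuityZ3.Theorems.PercNearOneGluingNoHeavyLowerTailAttachedChampionObserverExchange
import HarnessLib

/-!
# `NoHeavyLowerTail` (stmt-CriticalPhenomena-4575) — the attached-champion inequality XZ when the observer reaches
# the relays only through the champion and one other relay ("two gates")

Lead of the crux, 2026-08-18.  Notation of `…AttachedChampionObserverExchange.lean`: `μ = prodBernoulli w`, relays `A`,
level `j`, `M_x = |{a ∈ A : x ↔ a}|`, `N = M_o`, champion `q`.

* `attachedChampion_twoGate`: if every connection `o ↔ a` (`a ∈ A`) passes, as an event, through `b` or `q`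
  (`{o ↔ a} ⊆ {o ↔ b} ∪ {o ↔ q}` surely — e.g. the component of `o` in `G ∖ A` is adjacent only to `b` and `q`), then the
  registered stub `stub_attachedChampion` (XZ) holds for this `(w, A, o, q, j)`:
  `μ(1 ≤ N ≤ j) ≤ μ(M_q ≤ j, 1 ≤ N)`.
  Proof: `{1 ≤ N ≤ j} ⊆ ({o ↔ q} ∩ {M_q ≤ j}) ∪ ({o ↔ b} ∩ {o ↮ q} ∩ {M_b ≤ j})`; the second piece is bounded by
  `μ({o ↔ b} ∩ {o ↮ q} ∩ {M_q ≤ j})` using T_b (`observer_attached_champion`) and the fact that on `{o ↔ b} ∩ {o ↔ q}` the two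
  counts agree; the two pieces are disjoint and lie in `{M_q ≤ j} ∩ {1 ≤ N}`.
So XZ is proved for observers with relay boundary `⊆ {b, q}`; the first open configuration is a boundary `{b, b'}` of two
non-champion relays (numerically fine, lab/t_twoport.py).
-/

noncomputable section

namespace Summit.CriticalPhenomena.PercolationContinuityZ3.Theorems

open MeasureTheory Set Literature.Probability.LatticeModels Literature.Probability.Percolation
open scoped Classical BigOperators

open AttachedChampionObserverExchange in
/-- **XZ behind two gates.**  If `{o ↔ a} ⊆ {o ↔ b} ∪ {o ↔ q}` for every `a ∈ A` (surely), `b, q ∈ A`, and `q` is a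
level-`j` champion, then `μ(1 ≤ N ≤ j) ≤ μ(M_q ≤ j ∧ 1 ≤ N)` — the attached-champion inequality for this observer. -/
theorem attachedChampion_twoGate {n : ℕ} (w : Sym2 (Fin n) → unitInterval) (A : Finset (Fin n)) (o b q : Fin n)
    (j : ℕ) (hb : b ∈ A) (hq : q ∈ A)
    (hgate : ∀ ω : BondConfig (Fin n), ∀ a ∈ A, ω ∈ (openConn o a : Set (BondConfig (Fin n))) →
      ω ∈ (openConn o b : Set (BondConfig (Fin n))) ∨ ω ∈ (openConn o q : Set (BondConfig (Fin n))))
    (hchamp : ∀ a ∈ A,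
      (prodBernoulli w).real {ω : BondConfig (Fin n) | (A.filter fun x => ω ∈ openConn a x).card ≤ j} ≤
        (prodBernoulli w).real {ω : BondConfig (Fin n) | (A.filter fun x => ω ∈ openConn q x).card ≤ j}) :
    (prodBernoulli w).real {ω : BondConfig (Fin n) |
        1 ≤ (A.filter fun x => ω ∈ openConn o x).card ∧ (A.filter fun x => ω ∈ openConn o x).card ≤ j} ≤
      (prodBernoulli w).real {ω : BondConfig (Fin n) |
        (A.filter fun x => ω ∈ openConn q x).card ≤ j ∧ 1 ≤ (A.filter fun x => ω ∈ openConn o x).card} := by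
  set μ := prodBernoulli w with hμ
  set E : Set (BondConfig (Fin n)) := openConn o b with hE
  set Q : Set (BondConfig (Fin n)) := openConn o q with hQ
  set Rb : Set (BondConfig (Fin n)) := {ω | (A.filter fun x => ω ∈ openConn b x).card ≤ j} with hRb
  set Rq : Set (BondConfig (Fin n)) := {ω | (A.filter fun x => ω ∈ openConn q x).card ≤ j} with hRq
  set L : Set (BondConfig (Fin n)) := {ω | 1 ≤ (A.filter fun x => ω ∈ openConn o x).card ∧
    (A.filter fun x => ω ∈ openConn o x).card ≤ j} with hL
  set T : Set (BondConfig (Fin n)) := {ω | (A.filter fun x => ω ∈ openConn q x).card ≤ j ∧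
    1 ≤ (A.filter fun x => ω ∈ openConn o x).card} with hT
  have hmeas : ∀ s : Set (BondConfig (Fin n)), MeasurableSet s := fun _ => MeasurableSet.of_discrete
  -- counts agree along a connection
  have hoq : ∀ ω : BondConfig (Fin n), ω ∈ Q →
      (A.filter fun x => ω ∈ openConn o x).card = (A.filter fun x => ω ∈ openConn q x).card :=
    fun ω h => card_eq_of_reachable A h
  have hob : ∀ ω : BondConfig (Fin n), ω ∈ E →
      (A.filter fun x => ω ∈ openConn o x).card = (A.filter fun x => ω ∈ openConn b x).card :=
    fun ω h => card_eq_of_reachable A h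
  -- Step 1: `L ⊆ (Q ∩ Rq) ∪ (E ∩ Qᶜ ∩ Rb)`
  have hcover : L ⊆ (Q ∩ Rq) ∪ ((E ∩ Rb) \ Q) := by
    intro ω hω
    have h1 : 1 ≤ (A.filter fun x => ω ∈ openConn o x).card := hω.1
    obtain ⟨a, ha⟩ := Finset.card_pos.1 h1
    simp only [Finset.mem_filter] at ha
    rcases hgate ω a ha.1 ha.2 with hb' | hq'
    · by_cases hQ' : ω ∈ Q
      · left; exact ⟨hQ', by change _ ≤ j; rw [← hoq ω hQ']; exact hω.2⟩
      · right; exact ⟨⟨hb', by change _ ≤ j; rw [← hob ω hb']; exact hω.2⟩, hQ'⟩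
    · left; exact ⟨hq', by change _ ≤ j; rw [← hoq ω hq']; exact hω.2⟩
  -- Step 2: the second piece via T_b
  have hTb : μ.real (E ∩ Rb) ≤ μ.real (E ∩ Rq) := observer_attached_champion w A o b q j hb hchamp
  have hsame : (E ∩ Rb) ∩ Q = (E ∩ Rq) ∩ Q := by
    ext ω
    simp only [mem_inter_iff, hRb, hRq, mem_setOf_eq]
    constructor
    · rintro ⟨⟨hE', hR⟩, hQ'⟩
      exact ⟨⟨hE', by rw [← hoq ω hQ', hob ω hE']; exact hR⟩, hQ'⟩
    · rintro ⟨⟨hE', hR⟩, hQ'⟩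
      exact ⟨⟨hE', by rw [← hob ω hE', hoq ω hQ']; exact hR⟩, hQ'⟩
  have hsplit1 : μ.real (E ∩ Rb) = μ.real ((E ∩ Rb) ∩ Q) + μ.real ((E ∩ Rb) \ Q) :=
    (measureReal_inter_add_sdiff (μ := μ) (s := E ∩ Rb) (t := Q) (hmeas Q)).symm
  have hsplit2 : μ.real (E ∩ Rq) = μ.real ((E ∩ Rq) ∩ Q) + μ.real ((E ∩ Rq) \ Q) :=
    (measureReal_inter_add_sdiff (μ := μ) (s := E ∩ Rq) (t := Q) (hmeas Q)).symm
  have hpiece : μ.real ((E ∩ Rb) \ Q) ≤ μ.real ((E ∩ Rq) \ Q) := by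
    rw [hsame] at hsplit1; linarith
  -- Step 3: assemble; the two pieces on the right are disjoint and lie in `T`
  have hdisj : Disjoint (Q ∩ Rq) ((E ∩ Rq) \ Q) :=
    Set.disjoint_left.2 fun ω h1 h2 => h2.2 h1.1
  have hunion : μ.real ((Q ∩ Rq) ∪ ((E ∩ Rq) \ Q)) = μ.real (Q ∩ Rq) + μ.real ((E ∩ Rq) \ Q) :=
    measureReal_union hdisj (hmeas _)
  have hsubT : (Q ∩ Rq) ∪ ((E ∩ Rq) \ Q) ⊆ T := by
    rintro ω (⟨hQ', hR⟩ | ⟨⟨hE', hR⟩, _⟩)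
    · refine ⟨hR, Finset.card_pos.2 ⟨q, ?_⟩⟩
      simp only [Finset.mem_filter]; exact ⟨hq, hQ'⟩
    · refine ⟨hR, Finset.card_pos.2 ⟨b, ?_⟩⟩
      simp only [Finset.mem_filter]; exact ⟨hb, hE'⟩
  calc μ.real L ≤ μ.real ((Q ∩ Rq) ∪ ((E ∩ Rb) \ Q)) := measureReal_mono hcover (measure_ne_top μ _)
    _ ≤ μ.real (Q ∩ Rq) + μ.real ((E ∩ Rb) \ Q) := measureReal_union_le _ _
    _ ≤ μ.real (Q ∩ Rq) + μ.real ((E ∩ Rq) \ Q) := by linarith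
    _ = μ.real ((Q ∩ Rq) ∪ ((E ∩ Rq) \ Q)) := hunion.symm
    _ ≤ μ.real T := measureReal_mono hsubT (measure_ne_top μ _)

end Summit.CriticalPhenomena.PercolationContinuityZ3.Theorems

end
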